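import Mathlib.Tactic.NormNum.Prime
import HarnessLib

/-!
# BirchSwinnertonDyer — rank ≥ 2 observatory: small-prime `Fact` instances for the kernel certificates

HONEST FRAMING: per-curve certified theorems and census instruments; no claim on BSD in rank ≥ 2.

The per-curve kernel rank certificates (`Rank2ObservatoryKernelCerts*.lean`) reduce modulo good
primes `q < 60`; the reduction homomorphism `reduceMod V q` and the counts `zmodPointCount V q` take
`[Fact q.Prime]`. Mathlib provides the instances for `2` and `3`; this file provides them once for
`5 ≤ q ≤ 59`, so that the certificate files declare no definitions of their own.
-/

-- single-conjunct summit: `Summit.BirchSwinnertonDyer.BirchSwinnertonDyer.…` repeats the name by design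
set_option linter.dupNamespace false

namespace Summit.BirchSwinnertonDyer.BirchSwinnertonDyer.Rank2Observatory

/-- `5` is prime. [folklore] -/
instance fact_prime_5 : Fact (Nat.Prime 5) := ⟨by norm_num⟩

/-- `7` is prime. [folklore] -/
instance fact_prime_7 : Fact (Nat.Prime 7) := ⟨by norm_num⟩

/-- `11` is prime. [folklore] -/
instance fact_prime_11 : Fact (Nat.Prime 11) := ⟨by norm_num⟩

/-- `13` is prime. [folklore] -/
instance fact_prime_13 : Fact (Nat.Prime 13) := ⟨by norm_num⟩

/-- `17` is prime. [folklore] -/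
instance fact_prime_17 : Fact (Nat.Prime 17) := ⟨by norm_num⟩

/-- `19` is prime. [folklore] -/
instance fact_prime_19 : Fact (Nat.Prime 19) := ⟨by norm_num⟩

/-- `23` is prime. [folklore] -/
instance fact_prime_23 : Fact (Nat.Prime 23) := ⟨by norm_num⟩

/-- `29` is prime. [folklore] -/
instance fact_prime_29 : Fact (Nat.Prime 29) := ⟨by norm_num⟩

/-- `31` is prime. [folklore] -/
instance fact_prime_31 : Fact (Nat.Prime 31) := ⟨by norm_num⟩

/-- `37` is prime. [folklore] -/
instance fact_prime_37 : Fact (Nat.Prime 37) := ⟨by norm_num⟩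

/-- `41` is prime. [folklore] -/
instance fact_prime_41 : Fact (Nat.Prime 41) := ⟨by norm_num⟩

/-- `43` is prime. [folklore] -/
instance fact_prime_43 : Fact (Nat.Prime 43) := ⟨by norm_num⟩

/-- `47` is prime. [folklore] -/
instance fact_prime_47 : Fact (Nat.Prime 47) := ⟨by norm_num⟩

/-- `53` is prime. [folklore] -/
instance fact_prime_53 : Fact (Nat.Prime 53) := ⟨by norm_num⟩

/-- `59` is prime. [folklore] -/
instance fact_prime_59 : Fact (Nat.Prime 59) := ⟨by norm_num⟩

end Summit.BirchSwinnertonDyer.BirchSwinnertonDyer.Rank2Observatory
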